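import Mathlib.Algebra.MvPolynomial.PDeriv
import Mathlib.LinearAlgebra.Matrix.Determinant.Basic
import Mathlib.LinearAlgebra.Matrix.Block
import Literature.ModelTheory.PseudofiniteFields.EtaleOpenTopology
import HarnessLib

/-!
# Triangular charts are standard smooth loci

Topic `Literature/ModelTheory/PseudofiniteFields`.  Proof-only companion of `EtaleOpenTopology.lean`
(standard smooth data `SmoothDatum K m c = (g_1, …, g_c ; h ; cols)`, Jacobian minor
`SmoothDatum.minor = det (∂g_i/∂X_{cols j})`, locus `SmoothDatum.locus = {g = 0, h·Δ ≠ 0}`).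
Context: E. Walsberg, J. Ye, *Éz fields*, J. Algebra 614 (2023) [WalsbergYe2023], Thm C (smooth
subvarieties of `𝔸^m` enter through standard smooth pieces, Jacobian criterion), and the chart
induction for definable sets in pseudo-finite fields, which produces TRIANGULAR CHARTS: after a
coordinate equivalence `σ : Fin m ≃ Fin e ⊕ Fin k` (free coordinates `u = Sum.inl`, bound
coordinates `w = Sum.inr`) the chart is cut out by equations `D_1(u, w) = … = D_k(u, w) = 0`, a
localisation `h(u, w) ≠ 0` and the non-singularity conditions `∂D_j/∂w_j ≠ 0`, where `D_j` does
not involve `w_i` for `i < j` (`∂D_j/∂w_i = 0`).  The Jacobian matrix `(∂D_j/∂w_{j'})_{j,j'}` is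
then upper triangular, its determinant is `∏_j ∂D_j/∂w_j`, and the chart is literally the locus of
the standard smooth datum `(D ∘ σ ; h ∘ σ ; cols j = σ⁻¹ (inr j))`:

* `SmoothDatum.minor_mk_rename` — the Jacobian minor of equations renamed along an injective
  renaming `f`, on the columns `f (c' j)`, is the renamed determinant `det (∂g_i/∂X_{c' j})`
  (`MvPolynomial.pderiv_rename`, `AlgHom.map_det`);
* `SmoothDatum.det_pderiv_of_triangular` — for triangular equations the Jacobian determinant in
  the bound variables is the product of the diagonal partial derivatives
  (`Matrix.det_of_upperTriangular`);
* `SmoothDatum.exists_locus_eq_triangularChart` — the triangular chart is the locus of a standard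
  smooth datum of codimension `k` in `K^m` (over a domain `K`, so that a product is non-zero iff
  every factor is).

Everything is proved by direct computation with the definitions; no named fact is used, no new
definition is made.

## References

* E. Walsberg, J. Ye, *Éz fields*, J. Algebra 614 (2023) 611–649, Thm C (smooth subvarieties,
  Jacobian criterion). [WalsbergYe2023]
* W. Johnson, C.-M. Tran, E. Walsberg, J. Ye, *The étale-open topology and the stable fields
  conjecture*, J. Eur. Math. Soc. 26 (2024) 4033–4070, §7. [JohnsonTranWalsbergYe2024]

## Not here

Lower-triangular / block-triangular variants, general (non-coordinate) changes of variables, the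
chart induction itself.
-/

namespace Literature.ModelTheory.PseudofiniteFields

open MvPolynomial

namespace SmoothDatum

section CommRing

variable {K : Type*} [CommRing K] {m c : ℕ}

/-- **Jacobian minor of renamed equations**: for an injective renaming of variables
`f : ι → Fin m`, equations `g_i ∈ K[X_ι]` and distinguished source variables `c' j`, the Jacobian
minor of the datum `(rename f ∘ g ; H ; j ↦ f (c' j))` is the renamed determinant
`rename f (det (∂g_i/∂X_{c' j})_{i,j})` (the determinant commutes with the ring map `rename f`,
and `rename f` commutes with `∂/∂X` for `f` injective). [folklore] -/
theorem minor_mk_rename {ι : Type*} {f : ι → Fin m} (hf : Function.Injective f)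
    (g : Fin c → MvPolynomial ι K) (H : MvPolynomial (Fin m) K) (c' : Fin c → ι)
    (hc' : Function.Injective c') :
    minor (⟨fun i => rename f (g i), H, ⟨fun j => f (c' j), hf.comp hc'⟩⟩ : SmoothDatum K m c) =
      rename f (Matrix.of fun i j : Fin c => pderiv (c' j) (g i)).det := by
  rw [minor, AlgHom.map_det, AlgHom.mapMatrix_apply]
  congr 1
  ext i j
  simp [pderiv_rename hf]

/-- **Triangular Jacobian determinant**: if the equation `D_j ∈ K[u, w]` (`u = Sum.inl`,
`w = Sum.inr`) does not involve the bound variable `w_i` for `i < j` (`∂D_j/∂w_i = 0`), then the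
Jacobian matrix `(∂D_j/∂w_{j'})_{j,j'}` is upper triangular and its determinant is the product of
the diagonal entries `∏_j ∂D_j/∂w_j`. [folklore] -/
theorem det_pderiv_of_triangular {e k : ℕ} (D : Fin k → MvPolynomial (Fin e ⊕ Fin k) K)
    (htri : ∀ j i : Fin k, i < j → pderiv (Sum.inr i) (D j) = 0) :
    (Matrix.of fun j j' : Fin k => pderiv (Sum.inr j') (D j)).det =
      ∏ j, pderiv (Sum.inr j) (D j) := by
  rw [Matrix.det_of_upperTriangular
    (M := Matrix.of fun j j' : Fin k => pderiv (Sum.inr j') (D j)) fun j j' hjj' => htri j j' hjj']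
  simp

end CommRing

section IsDomain

variable {K : Type*} [CommRing K] [IsDomain K] {m e k : ℕ}

/-- **Triangular charts are standard smooth loci.**  Let `σ : Fin m ≃ Fin e ⊕ Fin k` split the
coordinates of `K^m` into free ones `u` (`Sum.inl`) and bound ones `w` (`Sum.inr`), let
`D_1, …, D_k, h ∈ K[u, w]` with `∂D_j/∂w_i = 0` for `i < j` (triangularity).  Then the triangular
chart `{x | D(x ∘ σ⁻¹) = 0, h(x ∘ σ⁻¹) ≠ 0, (∂D_j/∂w_j)(x ∘ σ⁻¹) ≠ 0 for all j}` is the locus of a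
standard smooth datum of codimension `k` in `K^m` — namely equations `D_j ∘ σ`, localisation
`h ∘ σ`, distinguished columns `σ⁻¹ (w_j)`: its Jacobian minor is `(∏_j ∂D_j/∂w_j) ∘ σ` by
triangularity, and over a domain a product is non-zero iff every factor is.
[cite: WalsbergYe2023, Thm C (smooth subvarieties), with the Jacobian criterion] -/
theorem exists_locus_eq_triangularChart (σ : Fin m ≃ Fin e ⊕ Fin k)
    (D : Fin k → MvPolynomial (Fin e ⊕ Fin k) K) (h : MvPolynomial (Fin e ⊕ Fin k) K)
    (htri : ∀ j i : Fin k, i < j → pderiv (Sum.inr i) (D j) = 0) :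
    ∃ S : SmoothDatum K m k, S.locus =
      {x | (∀ j, eval (x ∘ σ.symm) (D j) = 0) ∧ eval (x ∘ σ.symm) h ≠ 0 ∧
        ∀ j, eval (x ∘ σ.symm) (pderiv (Sum.inr j) (D j)) ≠ 0} := by
  refine ⟨⟨fun j => rename σ.symm (D j), rename σ.symm h,
    ⟨fun j => σ.symm (Sum.inr j), σ.symm.injective.comp Sum.inr_injective⟩⟩, Set.ext fun x => ?_⟩
  rw [mem_locus_iff, Set.mem_setOf_eq,
    minor_mk_rename σ.symm.injective D (rename σ.symm h) Sum.inr Sum.inr_injective,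
    det_pderiv_of_triangular D htri]
  simp only [eval_rename, map_prod, Finset.prod_ne_zero_iff, Finset.mem_univ, true_implies]

end IsDomain

end SmoothDatum

end Literature.ModelTheory.PseudofiniteFields
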